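import Mathlib
import HarnessLib
import Literature.NumberTheory.DiophantineGeometry.AbcWave0
import Literature.NumberTheory.DiophantineGeometry.BelyiDegree
import Literature.NumberTheory.DiophantineGeometry.BelyiWitnessChart

/-!
# The bad-prime floor for the Belyi degree of a four-pointed line

Let `deg_B(λ) = belyiDegree λ` be the Belyi degree of the four-pointed projective line
`(ℙ¹; 0, 1, ∞, λ)` (`BelyiDegree.lean`): the least degree of a finite map `φ : ℙ¹ → ℙ¹`
unramified outside `{0, 1, ∞}` with `φ({0, 1, ∞, λ}) ⊆ {0, 1, ∞}` (Liţcanu 2004; Zapponi 2009,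
Introduction; for Belyi polynomials Rodriguez 2013, "Belyi height"). This file records, as ONE
cited named fact `BadPrimeLeBelyiDegree`, the reduction-theoretic lower bound

  `deg_B(q) ≥ p` for every prime `p` modulo which the four points `0, 1, ∞, q` do not stay
  pairwise distinct,

for a RATIONAL fourth point `q ∈ ℚ` (badness at `p` reads `v_p(q) ≠ 0 ∨ v_p(1 - q) ≠ 0`), stated
through the tree's witness predicate `HasBelyiWitness d q` ("`(ℙ¹; 0,1,∞,q)` carries a Belyi map
of degree `d`", the normal form of route ABC/BelyiDegreeSmooth), and PROVES from it the shapes in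
which the abc routes consume it: for an abc triple `a + b = c`, every Belyi map of degree `d`
through `{0, 1, ∞, a/c}` has `d ≥ p` for every prime `p ∣ abc`, i.e. `deg_B(a/c) ≥ P(abc)` —

* `beckmannFloor_of_hasBelyiWitness` — route ABC/BelyiDegreeSmooth, item `BeckmannFloor`
  (`HasBelyiWitness d (a/c)` is `Iff.rfl`-equal to the term that route inlines);
* `belyiWitness_prime_le`, `primeFactors_le_of_belyiWitness` — route ABC/BelyiSqueeze (cruxes
  `DegBelyiLower`, `DegBelyiRadical`, …: four affine fibre points of cross-ratio `a/c`, `∞` not a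
  fibre point), through the proved chart change `HasBelyiWitness.of_crossRatio` of
  `BelyiWitnessChart.lean`;
* `le_belyiDegree_of_padicValRat_ne_zero` — the floor for `belyiDegree q` itself.

## Sources

* L. Zapponi, *On the Belyi degree(s) of a curve defined over a number field*,
  arXiv:0904.0967 (2009): Thm 1.3 (`deg_B(X, ℚ̄) ≥` the greatest stable prime of bad reduction;
  proof: Beckmann's Prop. 5.3 gives good reduction at every `p ∤ |G|`, `G` the monodromy
  group, and `G ↪ Sₙ` forces the prime divisors of `|G|` to be `≤ n = deg f`), and the last
  paragraph of the Introduction (the affine case, in particular `ℙ¹` minus four points, "carries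
  out naturally" and recovers the Belyi degree of an algebraic number of [Liţcanu]).
* S. Beckmann, *Ramified primes in the field of moduli of branched coverings of curves*,
  J. Algebra 125 (1989): Prop. 5.3 (reduction of the covering at `p ∤ |G|` when the base has good
  reduction and the branch locus does not become singular mod `p`), Thm 5.5, Cor. 5.7 (three
  rational branch points `{0, 1, ∞}`).
* J. Sijsling, J. Voight, *On computing Belyi maps*, Publ. Math. Besançon (2014),
  arXiv:1311.2529: Thm 31 (Beckmann's theorem for an arbitrary Belyi map `f` with monodromy
  group `G`: for `p ∤ #G`, `f` is defined with good reduction over a number field unramified at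
  `p`), and §1 (Belyi maps over `ℂ` and over `ℚ̄` are identified).
* J. Rodriguez, *Bounding the degree of Belyi polynomials*, J. Number Theory 133 (2013),
  arXiv:1104.2027: Thm 3 (elementary Newton-polygon proof for Belyi POLYNOMIALS: the Belyi
  height `𝓗(λ) ≥ p` whenever `v_p(λ) ≠ 0`), with the closing remark "every Belyi polynomial
  with rational number `a/b` in lowest terms as a root will have degree greater than or equal
  to every prime `p` that divides `ab`", and Example 5 (`𝓗(4) = 3`: the bound is attained,
  `3 ∣ 1 - 4`).

## Design choices

* Mathlib has no Belyi maps of curves, dessins or models of covers over rings of integers, so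
  neither Zapponi's Thm 1.3 (stable models) nor Beckmann's Prop. 5.3 is statable as printed;
  what IS statable, and what the abc routes consume, is the consequence for the four-pointed line
  with a rational fourth point, phrased through `HasBelyiWitness` (coprime `p, q ∈ ℂ[X]`,
  `max (deg p) (deg q) = d`, a degree drop so that `∞` is a special point, `d + 1` distinct roots
  of `p·q·(p − q)` — the Riemann–Hurwitz equality case, i.e. `p/q` is unramified outside
  `{0, 1, ∞}` — among them `0, 1, q`).
* Badness `v_p(q) ≠ 0 ∨ v_p(1 − q) ≠ 0` (`padicValRat`) says that the reduction of `q` modulo `p`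
  is `0`, `∞` or `1`; it is invariant under the anharmonic group (`q ↦ 1 − q`, `q ↦ q⁻¹`), as the
  symmetries `hasBelyiWitness_one_sub_iff` / `hasBelyiWitness_inv_iff` require.
* NOT here: Belyi's upper bound `deg_B(a/c) ≤ c`, the finer "`p` divides `|Mon φ|`", curves of
  positive genus, irrational algebraic `λ` (valuations of number fields).
* Discharge status: OPEN. The printed proofs go through good reduction of tame three-point
  covers (Grothendieck–Beckmann; Fulton), far from Mathlib; Rodriguez's elementary argument
  covers polynomial witnesses (`q` constant) only.
-/

namespace Literature.NumberTheory.DiophantineGeometry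

open Polynomial

/-- **Bad primes are at most the Belyi degree** (Beckmann 1989 / Zapponi 2009 / Rodriguez 2013),
for the four-pointed line `(ℙ¹; 0, 1, ∞, q)` with `q ∈ ℚ`: if `(ℙ¹; 0, 1, ∞, q)` carries a Belyi
map of degree `d` (`HasBelyiWitness d q`: coprime `p, q' ∈ ℂ[X]`, `max (deg p) (deg q') = d`,
`∞` a special point, `d + 1` distinct roots of `p·q'·(p − q')` so that `p/q'` is unramified outside
`{0, 1, ∞}`, and `0, 1, q` special), then every prime `p` modulo which `0, 1, ∞, q` do NOT stay
pairwise distinct — `v_p(q) ≠ 0` or `v_p(1 − q) ≠ 0` — satisfies `p ≤ d`; equivalently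
`belyiDegree q ≥ p` for every such `p` (`le_belyiDegree_of_padicValRat_ne_zero`).
Printed forms: Zapponi, Thm 1.3 — the Belyi degree of a curve over `ℚ̄` is `≥` its greatest
stable prime of bad reduction, because (Beckmann, Prop. 5.3; Sijsling–Voight, Thm 31) a Belyi
map with monodromy group `G` has good reduction at every `p ∤ |G|` while `G ↪ S_d` gives
`|G| ∣ d!`; Zapponi, Introduction (last paragraph) — the same for `ℙ¹` minus four points, i.e.
for the Belyi degree of an algebraic number; Rodriguez, Thm 3 — for Belyi polynomials,
elementarily, `𝓗(λ) ≥ p` when `v_p(λ) ≠ 0` ("every Belyi polynomial with rational number `a/b`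
in lowest terms as a root will have degree `≥` every prime that divides `ab`"), sharp by
Example 5 (`𝓗(4) = 3`, `3 ∣ 1 − 4`). Over `ℂ` = over `ℚ̄` for Belyi maps (Sijsling–Voight §1).
Stated for a rational fourth point only (the case the abc routes use); not yet proved in Lean
(needs good reduction of tame three-point covers).
[cite: Zapponi2009BelyiDegree, Thm 1.3 and Introduction (last paragraph)]
[cite: Beckmann1989, Prop 5.3, Thm 5.5, Cor 5.7] [cite: SijslingVoight2015, Thm 31 and §1]
[cite: Rodriguez2013, Thm 3 and Example 5] -/
def BadPrimeLeBelyiDegree : Prop :=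
  ∀ (q : ℚ) (d : ℕ), HasBelyiWitness d (q : ℂ) →
    ∀ p : ℕ, p.Prime → (padicValRat p q ≠ 0 ∨ padicValRat p (1 - q) ≠ 0) → p ≤ d

/-- The floor for the Belyi degree itself: if `(ℙ¹; 0, 1, ∞, q)` carries some Belyi witness
(true for every rational `q ∉ {0, 1}` by Belyi's construction, not proved here), then
`p ≤ belyiDegree q` for every prime `p` with `v_p(q) ≠ 0` or `v_p(1 − q) ≠ 0`.
[cite: Zapponi2009BelyiDegree, Thm 1.3 and Introduction (last paragraph)] -/
theorem le_belyiDegree_of_padicValRat_ne_zero (hB : BadPrimeLeBelyiDegree) {q : ℚ}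
    (hex : ∃ d, HasBelyiWitness d (q : ℂ)) {p : ℕ} (hp : p.Prime)
    (hbad : padicValRat p q ≠ 0 ∨ padicValRat p (1 - q) ≠ 0) : p ≤ belyiDegree (q : ℂ) :=
  hB q _ (hasBelyiWitness_belyiDegree hex) p hp hbad

/-- The floor in the cross-ratio normal form (route ABC/BelyiSqueeze), general rational `q`: a
degree-`n` Belyi map with four affine special points of cross-ratio `q` (and `∞` not special)
forces `p ≤ n` for every prime `p` with `v_p(q) ≠ 0` or `v_p(1 − q) ≠ 0`; via the proved chart
change `HasBelyiWitness.of_crossRatio`.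
[cite: Zapponi2009BelyiDegree, Thm 1.3 and Introduction (last paragraph)] -/
theorem prime_le_of_crossRatio (hB : BadPrimeLeBelyiDegree) {q : ℚ} {n : ℕ} {P Q : ℂ[X]}
    {x y z w : ℂ} (hcop : IsCoprime P Q) (hP : P.natDegree = n) (hQ : Q.natDegree = n)
    (hPQ : (P - Q).natDegree = n) (hcard : (P * Q * (P - Q)).roots.toFinset.card = n + 2)
    (h4 : ({x, y, z, w} : Finset ℂ).card = 4)
    (hsub : {x, y, z, w} ⊆ (P * Q * (P - Q)).roots.toFinset)
    (hcr : (w - x) * (y - z) = (q : ℂ) * ((w - z) * (y - x))) {p : ℕ} (hp : p.Prime)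
    (hbad : padicValRat p q ≠ 0 ∨ padicValRat p (1 - q) ≠ 0) : p ≤ n :=
  hB q n (HasBelyiWitness.of_crossRatio hcop hP hQ hPQ hcard h4 hsub hcr) p hp hbad

/-! ### abc triples -/

/-- For an abc triple `a + b = c` and a prime `p ∣ abc`, the four points `0, 1, ∞, a/c` collide
modulo `p`: `v_p(a/c) ≠ 0` (if `p ∣ a` or `p ∣ c`) or `v_p(1 − a/c) = v_p(b/c) ≠ 0` (if `p ∣ b`),
by pairwise coprimality. [folklore] -/
theorem IsABCTriple.padicValRat_div_ne_zero_or {a b c : ℕ} (h : IsABCTriple a b c) {p : ℕ}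
    (hp : p.Prime) (hpd : p ∣ a * b * c) :
    padicValRat p ((a : ℚ) / c) ≠ 0 ∨ padicValRat p (1 - (a : ℚ) / c) ≠ 0 := by
  haveI := Fact.mk hp
  obtain ⟨ha, hb, habc, hcop⟩ := h
  have ha0 : a ≠ 0 := Nat.pos_iff_ne_zero.mp ha
  have hb0 : b ≠ 0 := Nat.pos_iff_ne_zero.mp hb
  have hc0 : c ≠ 0 := by omega
  have hac : Nat.Coprime a c := by rw [← habc]; exact Nat.coprime_self_add_right.mpr hcop
  have hbc : Nat.Coprime b c := by
    rw [← habc]; exact Nat.coprime_add_self_right.mpr hcop.symm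
  have haQ : (a : ℚ) ≠ 0 := by exact_mod_cast ha0
  have hbQ : (b : ℚ) ≠ 0 := by exact_mod_cast hb0
  have hcQ : (c : ℚ) ≠ 0 := by exact_mod_cast hc0
  have h1 : 1 - (a : ℚ) / c = (b : ℚ) / c := by
    rw [eq_div_iff hcQ, sub_mul, div_mul_cancel₀ _ hcQ]
    have : (c : ℚ) = a + b := by exact_mod_cast habc.symm
    rw [this]; ring
  have hva : padicValRat p ((a : ℚ) / c) = (padicValNat p a : ℤ) - padicValNat p c := by
    rw [padicValRat.div haQ hcQ, padicValRat.of_nat, padicValRat.of_nat]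
  have hvb : padicValRat p ((b : ℚ) / c) = (padicValNat p b : ℤ) - padicValNat p c := by
    rw [padicValRat.div hbQ hcQ, padicValRat.of_nat, padicValRat.of_nat]
  rcases (Nat.Prime.dvd_mul hp).mp hpd with hab | hpc
  · rcases (Nat.Prime.dvd_mul hp).mp hab with hpa | hpb
    · -- `p ∣ a`, hence `p ∤ c`
      left
      have hnc : ¬ p ∣ c := fun hpc => by
        have hg := Nat.dvd_gcd hpa hpc
        rw [hac.gcd_eq_one] at hg
        exact hp.not_dvd_one hg
      have h1a : 1 ≤ padicValNat p a := one_le_padicValNat_of_dvd ha0 hpa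
      rw [hva, padicValNat.eq_zero_of_not_dvd hnc, Nat.cast_zero, sub_zero]
      exact Nat.cast_ne_zero.mpr (by omega)
    · -- `p ∣ b`, hence `p ∤ c`
      right
      have hnc : ¬ p ∣ c := fun hpc => by
        have hg := Nat.dvd_gcd hpb hpc
        rw [hbc.gcd_eq_one] at hg
        exact hp.not_dvd_one hg
      have h1b : 1 ≤ padicValNat p b := one_le_padicValNat_of_dvd hb0 hpb
      rw [h1, hvb, padicValNat.eq_zero_of_not_dvd hnc, Nat.cast_zero, sub_zero]
      exact Nat.cast_ne_zero.mpr (by omega)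
  · -- `p ∣ c`, hence `p ∤ a`
    left
    have hna : ¬ p ∣ a := fun hpa => by
      have hg := Nat.dvd_gcd hpa hpc
      rw [hac.gcd_eq_one] at hg
      exact hp.not_dvd_one hg
    have h1c : 1 ≤ padicValNat p c := one_le_padicValNat_of_dvd hc0 hpc
    rw [hva, padicValNat.eq_zero_of_not_dvd hna, Nat.cast_zero, zero_sub, neg_ne_zero]
    exact Nat.cast_ne_zero.mpr (by omega)

/-- **The floor in the normal form of route ABC/BelyiDegreeSmooth** (its item `BeckmannFloor`;
`HasBelyiWitness d (a/c)` is by `Iff.rfl` the term that route inlines): for an abc triple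
`a + b = c`, a Belyi witness of degree `d` on `(ℙ¹; 0, 1, ∞, a/c)` forces every prime factor `ℓ` of
`abc` to satisfy `ℓ ≤ d`, i.e. `deg_B(a/c) ≥ P(abc)`, the greatest prime factor. Derived from
`BadPrimeLeBelyiDegree`: `ℓ ∣ abc` makes `{0, 1, ∞, a/c}` collide modulo `ℓ`.
[cite: Zapponi2009BelyiDegree, Thm 1.3 and Introduction (last paragraph)] -/
theorem beckmannFloor_of_hasBelyiWitness (hB : BadPrimeLeBelyiDegree) {a b c d : ℕ}
    (h : IsABCTriple a b c) (hw : HasBelyiWitness d ((a : ℂ) / (c : ℂ))) :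
    ∀ ℓ ∈ (a * b * c).primeFactors, ℓ ≤ d := fun ℓ hℓ =>
  hB ((a : ℚ) / c) d (by simpa [Rat.cast_div, Rat.cast_natCast] using hw) ℓ
    (Nat.prime_of_mem_primeFactors hℓ)
    (h.padicValRat_div_ne_zero_or (Nat.prime_of_mem_primeFactors hℓ)
      (Nat.dvd_of_mem_primeFactors hℓ))

/-- **The floor in the normal form of route ABC/BelyiSqueeze** (the Beckmann–Zapponi–Rodriguez
floor requested there): for an abc triple `a + b = c`, every Belyi map of degree `n` through four
points of `ℙ¹` of cross-ratio `a/c` — coprime `P, Q ∈ ℂ[X]` with `deg P = deg Q = deg (P − Q) = n`,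
`n + 2` distinct roots of `P·Q·(P − Q)`, four distinct such roots `x, y, z, w` with
`(w − x)(y − z) = (a/c)·(w − z)(y − x)` — has `n ≥ p` for every prime `p ∣ abc`; in particular
`deg_B(a/c) ≥ P(abc)`. Derived from `BadPrimeLeBelyiDegree` through the proved chart change
`HasBelyiWitness.of_crossRatio`. [cite: Zapponi2009BelyiDegree, Thm 1.3 and Introduction (last paragraph)] -/
theorem belyiWitness_prime_le (hB : BadPrimeLeBelyiDegree) {a b c : ℕ} (h : IsABCTriple a b c)
    {n : ℕ}
    (hw : ∃ P Q : Polynomial ℂ, ∃ x y z w : ℂ, IsCoprime P Q ∧ P.natDegree = n ∧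
      Q.natDegree = n ∧ (P - Q).natDegree = n ∧ (P * Q * (P - Q)).roots.toFinset.card = n + 2 ∧
      ({x, y, z, w} : Finset ℂ).card = 4 ∧ {x, y, z, w} ⊆ (P * Q * (P - Q)).roots.toFinset ∧
      (w - x) * (y - z) = ((a : ℂ) / (c : ℂ)) * ((w - z) * (y - x)))
    {p : ℕ} (hp : p.Prime) (hpd : p ∣ a * b * c) : p ≤ n := by
  obtain ⟨P, Q, x, y, z, w, hcop, hP, hQ, hPQ, hcard, h4, hsub, hcr⟩ := hw
  have hw' : HasBelyiWitness n (((a : ℚ) / c : ℚ) : ℂ) := by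
    simpa [Rat.cast_div, Rat.cast_natCast] using
      HasBelyiWitness.of_crossRatio hcop hP hQ hPQ hcard h4 hsub hcr
  exact hB _ n hw' p hp (h.padicValRat_div_ne_zero_or hp hpd)

/-- The same floor in "greatest prime factor" form: a Belyi witness of degree `n` through `a/c`
(normal form of route ABC/BelyiSqueeze) forces `(a*b*c).primeFactors ⊆ [0, n]`.
[cite: Zapponi2009BelyiDegree, Thm 1.3 and Introduction (last paragraph)] -/
theorem primeFactors_le_of_belyiWitness (hB : BadPrimeLeBelyiDegree) {a b c : ℕ}
    (h : IsABCTriple a b c) {n : ℕ}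
    (hw : ∃ P Q : Polynomial ℂ, ∃ x y z w : ℂ, IsCoprime P Q ∧ P.natDegree = n ∧
      Q.natDegree = n ∧ (P - Q).natDegree = n ∧ (P * Q * (P - Q)).roots.toFinset.card = n + 2 ∧
      ({x, y, z, w} : Finset ℂ).card = 4 ∧ {x, y, z, w} ⊆ (P * Q * (P - Q)).roots.toFinset ∧
      (w - x) * (y - z) = ((a : ℂ) / (c : ℂ)) * ((w - z) * (y - x))) :
    ∀ p ∈ (a * b * c).primeFactors, p ≤ n := fun _ hp =>
  belyiWitness_prime_le hB h hw (Nat.prime_of_mem_primeFactors hp) (Nat.dvd_of_mem_primeFactors hp)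

/-- For an abc triple, the Belyi degree of `(ℙ¹; 0, 1, ∞, a/c)` is at least every prime factor of
`abc` — given any witness (e.g. Belyi's map of degree `c`, route item `BelyiTrivialBound`, or a
cross-ratio witness via `belyiDegree_le_of_crossRatio`). [cite: Zapponi2009BelyiDegree, Thm 1.3 and Introduction (last paragraph)] -/
theorem IsABCTriple.prime_le_belyiDegree (hB : BadPrimeLeBelyiDegree) {a b c : ℕ}
    (h : IsABCTriple a b c) (hex : ∃ d, HasBelyiWitness d ((a : ℂ) / (c : ℂ))) {p : ℕ}
    (hp : p.Prime) (hpd : p ∣ a * b * c) : p ≤ belyiDegree ((a : ℂ) / (c : ℂ)) := by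
  have h0 : a * b * c ≠ 0 := by
    obtain ⟨ha, hb, hsum, -⟩ := h
    exact mul_ne_zero (mul_ne_zero ha.ne' hb.ne') (by omega)
  exact beckmannFloor_of_hasBelyiWitness hB h (hasBelyiWitness_belyiDegree hex) p
    (Nat.mem_primeFactors.mpr ⟨hp, hpd, h0⟩)

end Literature.NumberTheory.DiophantineGeometry
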